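import Summits.AtomisticToContinuum.FouriersLaw.Theorems.VanishingNoiseTransferVanishingNoiseBoundFlipResolventInvariant
import Summits.AtomisticToContinuum.FouriersLaw.Theorems.VanishingNoiseTransferVanishingNoiseBoundFlipBindInvariant

/-!
# Flip steady state vs. steady state: the distance is controlled by the flip-ODD part of the
steady state (helper for stub S2' `stub_flipResponseEquidifferentiable`, line `fekete-usc-one-length`)

`--supports stmt-AtomisticToContinuum-11976` helper file (crux `VanishingNoiseBound`, route
`VanishingNoiseTransfer`). The fixed-length noise continuity of the line (`|Dε - D0| ≤ η` for the
responses of the unique flip-steady family at small flip rate `ε`, one length `N`) reduces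
(`…MixedLipschitzReduction.lean`, `of_uniformTransfer`) to a two-parameter transfer bound (UT):
`|J(με,δ) - J(μ0,δ)| ≤ K ε |δ|` for the steady currents of the flip and flip-free steady states at
the SAME temperatures `T ± δ/2`. The landed zeroth-order bound is `≤ M ε`
(`exists_flipSteadyState_near`, `…FlipContinuity.lean`); the factor `|δ|` must come from the
equilibrium point `δ = 0`, where both steady states are the (flip-invariant) Gibbs measure. This
file proves the MECHANISM producing that factor, for an abstract resolvent-type kernel and with all
constants explicit:

* `exists_flipSteadyState_sub_le_of_flipAsymmetry` — if `R` (Markov, resolvent identity at rate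
  `Nε`, Feller, `R e^{θH} ≤ a e^{θH} + b`) contracts towards an `R`-invariant probability measure
  `μ⋆` at rate `κ < 1` in the `e^{θH}`-weighted norm (`|Rg(z) - μ⋆(g)| ≤ κ e^{θH(z)}` for continuous
  `|g| ≤ e^{θH}`), and the flip-odd part of `μ⋆` is bounded by `A`
  (`|μ⋆(h∘flip_i) - μ⋆(h)| ≤ A`, all sites, continuous `|h| ≤ e^{θH}`), then some weak flip steady
  state `μ` of `L + εS` has `|μ(g) - μ⋆(g)| ≤ A κ/(1-κ)` for all continuous `|g| ≤ e^{θH}`.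

Mechanism (the embedded chain at the flip times; `Q` = flip a uniformly chosen momentum):
`μ = π R` with `π = μ Q` (`exists_isFlipSteadyState_bind_invariant`), so `μ(g) = μ(Q(Rg))`, while
`μ⋆(Rg) = μ⋆(g)`; with `F := Rg - μ⋆(g)` (`|F| ≤ κ e^{θH}`),
`μ(g) - μ⋆(g) = [μ(QF) - μ⋆(QF)] + μ⋆(QF - F)`: the first bracket is the same functional at the
smaller observable `QF` (contraction `κ`), the second is a flip-odd expectation of `μ⋆` (`≤ κA`);
iterate and let `n → ∞`, then remove boundedness of `g` by truncation. For the pinned chain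
(`…FlipAsymmetryTransferPinned.lean`) `R = R_{Nε}` contracts at rate `κ = M N ε`
(`exists_resolventKernel_invariant`; the embedded spectral gap IMPROVES as `ε → 0`), so the flip
steady state is within `2 M N ε · Asym(μ⋆)` of the steady state `μ⋆`, where `Asym(μ⋆) = 0` at equal
temperatures. What remains for (UT), hence for the line's fixed-length noise continuity, is
(i) `M` uniform for temperatures near `(T,T)` and (ii) `Asym(μ⋆_{T+δ/2,T-δ/2}) = O(δ)` — two
statements about the DETERMINISTIC chain. No definitions.
-/

noncomputable section

namespace Summit.AtomisticToContinuum.FouriersLaw.Theorems.FixedLengthNoiseContinuity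

open MeasureTheory ProbabilityTheory Filter Topology Set
open scoped NNReal ENNReal ContDiff BoundedContinuousFunction
open Literature.MathematicalPhysics.KineticTheory.HeatConduction
open Literature.Probability.Process

/-! ## §1 The transfer estimate for an abstract resolvent-type kernel -/

section Abstract

variable {ω₂ lam β γ : ℝ} {N : ℕ}

/-- **Flip steady state vs. steady state: the distance is controlled by the flip-odd part of the
steady state.** Let `P = pinnedChain ω₂ lam β γ` (`ω₂ > 0`, `lam, β ≥ 0`), `N ≥ 1`, `E = e^{θH}`
(`θ > 0`), `R` a Markov kernel with the resolvent identity at rate `Nε` on `C_c^∞`, Feller, and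
`R E ≤ a E + b` (`a < 1`, `b < ∞`); let `μ⋆` be a probability measure with `∫ E dμ⋆ < ∞`,
INVARIANT for `R` (`μ⋆ R = μ⋆`), towards which `R` CONTRACTS at rate `κ < 1` in the `E`-weighted
norm: `|R g(z) - μ⋆(g)| ≤ κ E(z)` for continuous `|g| ≤ E`; and suppose the flip-odd part of `μ⋆` is
bounded by `A`: `|μ⋆(h ∘ flip_i) - μ⋆(h)| ≤ A` for every site `i` and continuous `|h| ≤ E`. Then some
weak flip steady state `μ` of `L + εS` satisfies `|μ(g) - μ⋆(g)| ≤ A κ/(1 - κ)` for all continuous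
`|g| ≤ E`. Proof: `μ = π R` with `π = μ Q` (`exists_isFlipSteadyState_bind_invariant`), so
`μ(g) = μ(Q(Rg))`; writing `Rg = F + μ⋆(g)` with `|F| ≤ κ E ‖g‖_E` and using `μ⋆(F) = 0`
(invariance), `μ(g) - μ⋆(g) = [μ(QF) - μ⋆(QF)] + μ⋆(QF - F)`, where `QF = N⁻¹∑_i F∘flip_i` is
again continuous with `|QF| ≤ κ E ‖g‖_E` and `|μ⋆(QF - F)| ≤ κ A ‖g‖_E`; iterating `n` times and
letting `n → ∞` (`κ < 1`; the zeroth bound is `∫ E dμ + ∫ E dμ⋆`) gives the claim for bounded `g`,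
and monotone truncation (dominated convergence, `E` integrable for `μ` and `μ⋆`) for all `g`. In
particular a flip-INVARIANT `R`-invariant `μ⋆` (`A = 0`) is itself approached exactly: `μ = μ⋆` on
`E`-dominated observables. -/
theorem exists_flipSteadyState_sub_le_of_flipAsymmetry (hω : 0 < ω₂) (hl : 0 ≤ lam) (hβ : 0 ≤ β)
    (hN : 0 < N) (T_L T_R ε : ℝ)
    (R : Kernel (PhaseSpace N) (PhaseSpace N)) [IsMarkovKernel R]
    (hres : ∀ f : PhaseSpace N → ℝ, ContDiff ℝ ∞ f → HasCompactSupport f → ∀ z : PhaseSpace N,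
        ∫ y, (pinnedChain ω₂ lam β γ).generator N T_L T_R f y ∂(R z) =
          (N * ε) * (∫ y, f y ∂(R z) - f z))
    (hfeller : ∀ g : PhaseSpace N →ᵇ ℝ, Continuous fun z => ∫ y, g y ∂(R z))
    {θ : ℝ} (hθ : 0 < θ) {a b : ℝ≥0∞} (ha : a < 1) (hb : b ≠ ⊤)
    (hlyap : ∀ z : PhaseSpace N,
        ∫⁻ y, ENNReal.ofReal (Real.exp (θ * (pinnedChain ω₂ lam β γ).hamiltonian N y)) ∂(R z) ≤
          a * ENNReal.ofReal (Real.exp (θ * (pinnedChain ω₂ lam β γ).hamiltonian N z)) + b)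
    (μs : Measure (PhaseSpace N)) [IsProbabilityMeasure μs]
    (hμsV : ∫⁻ y, ENNReal.ofReal (Real.exp (θ * (pinnedChain ω₂ lam β γ).hamiltonian N y)) ∂μs ≠ ⊤)
    (hinvR : μs.bind R = μs)
    {κ : ℝ} (hκ0 : 0 ≤ κ) (hκ1 : κ < 1)
    (hcontr : ∀ g : PhaseSpace N → ℝ, Continuous g →
      (∀ y, |g y| ≤ Real.exp (θ * (pinnedChain ω₂ lam β γ).hamiltonian N y)) →
      ∀ z : PhaseSpace N, |∫ y, g y ∂(R z) - ∫ y, g y ∂μs| ≤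
        κ * Real.exp (θ * (pinnedChain ω₂ lam β γ).hamiltonian N z))
    {A : ℝ} (hA : 0 ≤ A)
    (hasym : ∀ (i : Fin N) (h : PhaseSpace N → ℝ), Continuous h →
      (∀ y, |h y| ≤ Real.exp (θ * (pinnedChain ω₂ lam β γ).hamiltonian N y)) →
      |∫ y, h (momentumFlip i y) ∂μs - ∫ y, h y ∂μs| ≤ A) :
    ∃ μ : Measure (PhaseSpace N), (pinnedChain ω₂ lam β γ).IsFlipSteadyState N T_L T_R ε μ ∧
      ∀ g : PhaseSpace N → ℝ, Continuous g →
        (∀ y, |g y| ≤ Real.exp (θ * (pinnedChain ω₂ lam β γ).hamiltonian N y)) →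
        |∫ y, g y ∂μ - ∫ y, g y ∂μs| ≤ A * κ / (1 - κ) := by
  set P := pinnedChain ω₂ lam β γ with hPdef
  set E : PhaseSpace N → ℝ := fun y => Real.exp (θ * P.hamiltonian N y) with hEdef
  have hNR : (N : ℝ) ≠ 0 := Nat.cast_ne_zero.2 hN.ne'
  have hEpos : ∀ y, 0 < E y := fun y => Real.exp_pos _
  have hEcont : Continuous E :=
    Real.continuous_exp.comp (continuous_const.mul (pinnedChain_continuous_hamiltonian ω₂ lam β γ N))
  have hEflip : ∀ (i : Fin N) (y : PhaseSpace N), E (momentumFlip i y) = E y := by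
    intro i y
    simp only [hEdef, OscillatorChain.hamiltonian_momentumFlip]
  have hVm : Measurable fun y => ENNReal.ofReal (E y) := ENNReal.measurable_ofReal.comp hEcont.measurable
  -- the flip steady state `μ = π R` with `π = μ Q`
  obtain ⟨π, hπ, hflip, hπV, hπinv⟩ := exists_isFlipSteadyState_bind_invariant hω hl hβ hN T_L T_R ε
    R hres hfeller hθ ha hb hlyap
  set μ : Measure (PhaseSpace N) := π.bind R with hμdef
  haveI hμP : IsProbabilityMeasure μ := hflip.1
  refine ⟨μ, hflip, ?_⟩
  -- exponential moments and integrability of `E`-dominated continuous functions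
  have hμV : ∫⁻ y, ENNReal.ofReal (E y) ∂μ ≠ ⊤ := by
    have h := Literature.Probability.Process.MarkovChain.lintegral_bind_le_of_lyapunov R hVm hlyap π
    rw [measure_univ, mul_one] at h
    refine (h.trans_lt (ENNReal.add_lt_top.2 ⟨ENNReal.mul_lt_top (ha.trans_le le_top) ?_,
      hb.lt_top⟩)).ne
    exact hπV.trans_lt (ENNReal.div_lt_top hb (tsub_pos_of_lt ha).ne')
  have hEint : ∀ (ν : Measure (PhaseSpace N)), ∫⁻ y, ENNReal.ofReal (E y) ∂ν ≠ ⊤ → Integrable E ν := by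
    intro ν hν
    refine ⟨hEcont.aestronglyMeasurable, ?_⟩
    rw [hasFiniteIntegral_iff_enorm]
    have he : ∀ y, ‖E y‖ₑ = ENNReal.ofReal (E y) := fun y => Real.enorm_eq_ofReal (hEpos y).le
    simp only [he]
    exact hν.lt_top
  have hdomint : ∀ (ν : Measure (PhaseSpace N)), ∫⁻ y, ENNReal.ofReal (E y) ∂ν ≠ ⊤ →
      ∀ (c : ℝ) (g : PhaseSpace N → ℝ), Continuous g → (∀ y, |g y| ≤ c * E y) → Integrable g ν := by
    intro ν hν c g hg hgc
    exact ((hEint ν hν).const_mul c).mono' hg.aestronglyMeasurable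
      (Eventually.of_forall fun y => by rw [Real.norm_eq_abs]; exact hgc y)
  have hZμ : ∫ y, E y ∂μ = (∫⁻ y, ENNReal.ofReal (E y) ∂μ).toReal :=
    integral_eq_lintegral_of_nonneg_ae (Eventually.of_forall fun y => (hEpos y).le)
      hEcont.aestronglyMeasurable
  have hZs : ∫ y, E y ∂μs = (∫⁻ y, ENNReal.ofReal (E y) ∂μs).toReal :=
    integral_eq_lintegral_of_nonneg_ae (Eventually.of_forall fun y => (hEpos y).le)
      hEcont.aestronglyMeasurable
  -- homogeneous forms of the contraction and of the flip asymmetry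
  have hcontr' : ∀ (c : ℝ), 0 ≤ c → ∀ g : PhaseSpace N → ℝ, Continuous g → (∀ y, |g y| ≤ c * E y) →
      ∀ z, |∫ y, g y ∂(R z) - ∫ y, g y ∂μs| ≤ c * κ * E z := by
    intro c hc g hg hgc z
    rcases hc.eq_or_lt with h0 | hcpos
    · subst h0
      have hg0 : g = fun _ => 0 := funext fun y => abs_nonpos_iff.1 (by simpa using hgc y)
      subst hg0
      simp
    · have h := hcontr (fun y => g y / c) (hg.div_const c) (fun y => by
        rw [abs_div, abs_of_pos hcpos, div_le_iff₀ hcpos, mul_comm]; exact hgc y) z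
      rw [integral_div, integral_div, ← sub_div, abs_div, abs_of_pos hcpos,
        div_le_iff₀ hcpos] at h
      linarith [h]
  have hasym' : ∀ (c : ℝ), 0 ≤ c → ∀ (i : Fin N) (h : PhaseSpace N → ℝ), Continuous h →
      (∀ y, |h y| ≤ c * E y) → |∫ y, h (momentumFlip i y) ∂μs - ∫ y, h y ∂μs| ≤ c * A := by
    intro c hc i h hh hhc
    rcases hc.eq_or_lt with h0 | hcpos
    · subst h0
      have hh0 : h = fun _ => 0 := funext fun y => abs_nonpos_iff.1 (by simpa using hhc y)
      subst hh0
      simp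
    · have h1 := hasym i (fun y => h y / c) (hh.div_const c) (fun y => by
        rw [abs_div, abs_of_pos hcpos, div_le_iff₀ hcpos, mul_comm]; exact hhc y)
      rw [integral_div, integral_div, ← sub_div, abs_div, abs_of_pos hcpos,
        div_le_iff₀ hcpos] at h1
      linarith [h1]
  -- `R g` for bounded continuous `g`: continuous and bounded
  have hRcont : ∀ g : PhaseSpace N → ℝ, Continuous g → ∀ C : ℝ, (∀ x, ‖g x‖ ≤ C) →
      Continuous fun z => ∫ y, g y ∂(R z) := by
    intro g hg C hC
    simpa using hfeller (BoundedContinuousFunction.ofNormedAddCommGroup g hg C hC)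
  have hRbd : ∀ g : PhaseSpace N → ℝ, ∀ C : ℝ, (∀ x, ‖g x‖ ≤ C) → ∀ z, ‖∫ y, g y ∂(R z)‖ ≤ C := by
    intro g C hC z
    simpa using norm_integral_le_of_norm_le_const (μ := R z) (Eventually.of_forall hC)
  have hbddint : ∀ {g : PhaseSpace N → ℝ}, Continuous g → ∀ {C : ℝ}, (∀ x, ‖g x‖ ≤ C) →
      ∀ (ν : Measure (PhaseSpace N)) [IsFiniteMeasure ν], Integrable g ν := by
    intro g hg C hC ν _
    exact (integrable_const C).mono' hg.aestronglyMeasurable (Eventually.of_forall hC)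
  -- ONE STEP: `μ(g) - μ⋆(g) = [μ(QF) - μ⋆(QF)] + μ⋆(QF - F)`
  have hstep : ∀ (c : ℝ), 0 ≤ c → ∀ g : PhaseSpace N → ℝ, Continuous g → (∃ C : ℝ, ∀ x, ‖g x‖ ≤ C) →
      (∀ y, |g y| ≤ c * E y) →
      ∃ g₁ : PhaseSpace N → ℝ, Continuous g₁ ∧ (∃ C : ℝ, ∀ x, ‖g₁ x‖ ≤ C) ∧
        (∀ y, |g₁ y| ≤ c * κ * E y) ∧
        |∫ y, g y ∂μ - ∫ y, g y ∂μs| ≤ |∫ y, g₁ y ∂μ - ∫ y, g₁ y ∂μs| + c * κ * A := by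
    intro c hc g hg hgC hgc
    obtain ⟨C, hC⟩ := hgC
    set m : ℝ := ∫ y, g y ∂μs with hm
    set F : PhaseSpace N → ℝ := fun z => ∫ y, g y ∂(R z) - m with hF
    set QF : PhaseSpace N → ℝ := fun x => (N : ℝ)⁻¹ * ∑ i : Fin N, F (momentumFlip i x) with hQF
    have hFcont : Continuous F := (hRcont g hg C hC).sub continuous_const
    have hFbd : ∀ x, ‖F x‖ ≤ C + ‖m‖ := fun x => by
      have h1 := hRbd g C hC x
      have h2 := norm_sub_le (∫ y, g y ∂(R x)) m
      show ‖∫ y, g y ∂(R x) - m‖ ≤ C + ‖m‖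
      linarith
    have hFE : ∀ z, |F z| ≤ c * κ * E z := fun z => hcontr' c hc g hg hgc z
    have hQFcont : Continuous QF := continuous_const.mul
      (continuous_finsetSum _ fun i _ => hFcont.comp (continuous_momentumFlip i))
    have hQFbd : ∀ x, ‖QF x‖ ≤ C + ‖m‖ := by
      intro x
      rw [hQF, norm_mul, norm_inv, Real.norm_natCast]
      calc (N : ℝ)⁻¹ * ‖∑ i : Fin N, F (momentumFlip i x)‖
          ≤ (N : ℝ)⁻¹ * ∑ i : Fin N, ‖F (momentumFlip i x)‖ :=
            mul_le_mul_of_nonneg_left (norm_sum_le _ _) (by positivity)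
        _ ≤ (N : ℝ)⁻¹ * ∑ _i : Fin N, (C + ‖m‖) :=
            mul_le_mul_of_nonneg_left (Finset.sum_le_sum fun i _ => hFbd _) (by positivity)
        _ = C + ‖m‖ := by
            rw [Finset.sum_const, Finset.card_univ, Fintype.card_fin, nsmul_eq_mul, ← mul_assoc,
              inv_mul_cancel₀ hNR, one_mul]
    have hQFE : ∀ x, |QF x| ≤ c * κ * E x := by
      intro x
      rw [hQF, abs_mul, abs_inv, Nat.abs_cast]
      calc (N : ℝ)⁻¹ * |∑ i : Fin N, F (momentumFlip i x)|
          ≤ (N : ℝ)⁻¹ * ∑ i : Fin N, |F (momentumFlip i x)| :=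
            mul_le_mul_of_nonneg_left (Finset.abs_sum_le_sum_abs _ _) (by positivity)
        _ ≤ (N : ℝ)⁻¹ * ∑ _i : Fin N, c * κ * E x :=
            mul_le_mul_of_nonneg_left (Finset.sum_le_sum fun i _ => by
              rw [← hEflip i x]; exact hFE _) (by positivity)
        _ = c * κ * E x := by
            rw [Finset.sum_const, Finset.card_univ, Fintype.card_fin, nsmul_eq_mul, ← mul_assoc,
              inv_mul_cancel₀ hNR, one_mul]
    refine ⟨QF, hQFcont, ⟨C + ‖m‖, hQFbd⟩, hQFE, ?_⟩
    -- (a) `μ(g) = μ(Q(Rg)) = μ(QF) + m`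
    have hK1 : ∫ y, g y ∂μ = ∫ x, QF x ∂μ + m := by
      have h1 : ∫ y, g y ∂μ = ∫ z, ∫ y, g y ∂(R z) ∂π :=
        Literature.Probability.Process.MarkovChain.integral_bind_eq_integral_integral R π
          hg.stronglyMeasurable hC
      have h2 := hπinv (fun z => ∫ y, g y ∂(R z)) (hRcont g hg C hC).stronglyMeasurable C
        (hRbd g C hC)
      have h3 : (fun x => (N : ℝ)⁻¹ * ∑ i : Fin N, ∫ y, g y ∂(R (momentumFlip i x))) =
          fun x => QF x + m := by
        funext x
        simp only [hQF, hF, Finset.sum_sub_distrib, Finset.sum_const, Finset.card_univ,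
          Fintype.card_fin, nsmul_eq_mul, mul_sub, ← mul_assoc, inv_mul_cancel₀ hNR, one_mul]
        ring
      rw [h1, h2, h3, integral_add (hbddint hQFcont hQFbd μ) (integrable_const m), integral_const,
        probReal_univ, one_smul]
    -- (b) `μ⋆(F) = 0` by invariance
    have hF0 : ∫ z, F z ∂μs = 0 := by
      have h1 : ∫ y, g y ∂(μs.bind R) = ∫ z, ∫ y, g y ∂(R z) ∂μs :=
        Literature.Probability.Process.MarkovChain.integral_bind_eq_integral_integral R μs
          hg.stronglyMeasurable hC
      rw [hinvR] at h1
      simp only [hF]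
      rw [integral_sub (hbddint (hRcont g hg C hC) (hRbd g C hC) μs) (integrable_const m),
        integral_const, probReal_univ, one_smul, ← h1, hm, sub_self]
    -- (c) `|μ⋆(QF) - μ⋆(F)| ≤ c κ A`
    have hQFF : |∫ x, QF x ∂μs - ∫ x, F x ∂μs| ≤ c * κ * A := by
      have hFi : ∀ i : Fin N, Integrable (fun x => F (momentumFlip i x)) μs := fun i =>
        hbddint (hFcont.comp (continuous_momentumFlip i)) (fun x => hFbd _) μs
      have h1 : ∫ x, QF x ∂μs = (N : ℝ)⁻¹ * ∑ i : Fin N, ∫ x, F (momentumFlip i x) ∂μs := by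
        simp only [hQF]
        rw [integral_const_mul, integral_finsetSum _ fun i _ => hFi i]
      have h2 : ∫ x, F x ∂μs = (N : ℝ)⁻¹ * ∑ _i : Fin N, ∫ x, F x ∂μs := by
        rw [Finset.sum_const, Finset.card_univ, Fintype.card_fin, nsmul_eq_mul, ← mul_assoc,
          inv_mul_cancel₀ hNR, one_mul]
      rw [h1, h2, ← mul_sub, ← Finset.sum_sub_distrib, abs_mul, abs_inv, Nat.abs_cast]
      calc (N : ℝ)⁻¹ * |∑ i : Fin N, (∫ x, F (momentumFlip i x) ∂μs - ∫ x, F x ∂μs)|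
          ≤ (N : ℝ)⁻¹ * ∑ i : Fin N, |∫ x, F (momentumFlip i x) ∂μs - ∫ x, F x ∂μs| :=
            mul_le_mul_of_nonneg_left (Finset.abs_sum_le_sum_abs _ _) (by positivity)
        _ ≤ (N : ℝ)⁻¹ * ∑ _i : Fin N, c * κ * A :=
            mul_le_mul_of_nonneg_left (Finset.sum_le_sum fun i _ =>
              hasym' (c * κ) (mul_nonneg hc hκ0) i F hFcont hFE) (by positivity)
        _ = c * κ * A := by
            rw [Finset.sum_const, Finset.card_univ, Fintype.card_fin, nsmul_eq_mul, ← mul_assoc,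
              inv_mul_cancel₀ hNR, one_mul]
    -- assemble
    have e : ∫ y, g y ∂μ - ∫ y, g y ∂μs =
        (∫ x, QF x ∂μ - ∫ x, QF x ∂μs) + (∫ x, QF x ∂μs - ∫ x, F x ∂μs) := by
      rw [hK1, ← hm]
      linarith [hF0]
    rw [e]
    have h3 := abs_add_le (∫ x, QF x ∂μ - ∫ x, QF x ∂μs) (∫ x, QF x ∂μs - ∫ x, F x ∂μs)
    linarith [h3, hQFF]
  -- ITERATION: `|μ(g) - μ⋆(g)| ≤ c (κ A ∑_{k<n} κ^k + κ^n Z)` for bounded continuous `|g| ≤ c E`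
  set Z : ℝ := ∫ y, E y ∂μ + ∫ y, E y ∂μs with hZ
  have hiter : ∀ (n : ℕ) (c : ℝ), 0 ≤ c → ∀ g : PhaseSpace N → ℝ, Continuous g →
      (∃ C : ℝ, ∀ x, ‖g x‖ ≤ C) → (∀ y, |g y| ≤ c * E y) →
      |∫ y, g y ∂μ - ∫ y, g y ∂μs| ≤
        c * (κ * A * (∑ k ∈ Finset.range n, κ ^ k) + κ ^ n * Z) := by
    intro n
    induction n with
    | zero =>
      intro c hc g hg _ hgc
      rw [Finset.sum_range_zero, mul_zero, zero_add, pow_zero, one_mul]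
      have h1 : |∫ y, g y ∂μ| ≤ c * ∫ y, E y ∂μ := by
        rw [← integral_const_mul]
        refine (abs_integral_le_integral_abs).trans (integral_mono_of_nonneg
          (Eventually.of_forall fun y => abs_nonneg _) ((hEint μ hμV).const_mul c)
          (Eventually.of_forall fun y => hgc y))
      have h2 : |∫ y, g y ∂μs| ≤ c * ∫ y, E y ∂μs := by
        rw [← integral_const_mul]
        refine (abs_integral_le_integral_abs).trans (integral_mono_of_nonneg
          (Eventually.of_forall fun y => abs_nonneg _) ((hEint μs hμsV).const_mul c)
          (Eventually.of_forall fun y => hgc y))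
      calc |∫ y, g y ∂μ - ∫ y, g y ∂μs| ≤ |∫ y, g y ∂μ| + |∫ y, g y ∂μs| := abs_sub _ _
        _ ≤ c * ∫ y, E y ∂μ + c * ∫ y, E y ∂μs := add_le_add h1 h2
        _ = c * Z := by rw [hZ]; ring
    | succ n ih =>
      intro c hc g hg hgC hgc
      obtain ⟨g₁, hg₁, hg₁C, hg₁c, hle⟩ := hstep c hc g hg hgC hgc
      have h1 := ih (c * κ) (mul_nonneg hc hκ0) g₁ hg₁ hg₁C hg₁c
      have h2 : |∫ y, g₁ y ∂μ - ∫ y, g₁ y ∂μs| + c * κ * A ≤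
          c * κ * (κ * A * (∑ k ∈ Finset.range n, κ ^ k) + κ ^ n * Z) + c * κ * A := by
        linarith [h1]
      refine (hle.trans h2).trans (le_of_eq ?_)
      rw [Finset.sum_range_succ', pow_zero, pow_succ]
      have : ∑ k ∈ Finset.range n, κ ^ (k + 1) = κ * ∑ k ∈ Finset.range n, κ ^ k := by
        rw [Finset.mul_sum]
        exact Finset.sum_congr rfl fun k _ => by ring
      rw [this]
      ring
  -- LIMIT `n → ∞`: `|μ(g) - μ⋆(g)| ≤ κ A/(1-κ)` for bounded continuous `|g| ≤ E`
  have hgeom : ∀ n : ℕ, ∑ k ∈ Finset.range n, κ ^ k ≤ (1 - κ)⁻¹ := fun n =>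
    sum_le_hasSum (Finset.range n) (fun k _ => pow_nonneg hκ0 k) (hasSum_geometric_of_lt_one hκ0 hκ1)
  have hZ0 : 0 ≤ Z := add_nonneg (integral_nonneg fun y => (hEpos y).le)
    (integral_nonneg fun y => (hEpos y).le)
  have hbdd : ∀ g : PhaseSpace N → ℝ, Continuous g → (∃ C : ℝ, ∀ x, ‖g x‖ ≤ C) →
      (∀ y, |g y| ≤ E y) → |∫ y, g y ∂μ - ∫ y, g y ∂μs| ≤ A * κ / (1 - κ) := by
    intro g hg hgC hgE
    have h1 : ∀ n : ℕ, |∫ y, g y ∂μ - ∫ y, g y ∂μs| ≤ A * κ / (1 - κ) + κ ^ n * Z := by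
      intro n
      have h := hiter n 1 zero_le_one g hg hgC (fun y => by rw [one_mul]; exact hgE y)
      rw [one_mul] at h
      have h2 : κ * A * (∑ k ∈ Finset.range n, κ ^ k) ≤ A * κ / (1 - κ) := by
        rw [div_eq_mul_inv, mul_comm A κ]
        exact mul_le_mul_of_nonneg_left (hgeom n) (mul_nonneg hκ0 hA)
      linarith [h, h2]
    have hlim : Tendsto (fun n : ℕ => A * κ / (1 - κ) + κ ^ n * Z) atTop (𝓝 (A * κ / (1 - κ) + 0 * Z)) :=
      tendsto_const_nhds.add ((tendsto_pow_atTop_nhds_zero_of_lt_one hκ0 hκ1).mul_const Z)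
    rw [zero_mul, add_zero] at hlim
    exact ge_of_tendsto' hlim h1
  -- TRUNCATION: all continuous `|g| ≤ E`
  intro g hg hgE
  set gn : ℕ → PhaseSpace N → ℝ := fun n y => max (-(n : ℝ)) (min (g y) n) with hgn
  have hgn_cont : ∀ n, Continuous (gn n) := fun n =>
    continuous_const.max (hg.min continuous_const)
  have hgn_bd : ∀ n (y : PhaseSpace N), ‖gn n y‖ ≤ n := by
    intro n y
    rw [Real.norm_eq_abs, abs_le]
    exact ⟨le_max_left _ _, max_le (by linarith [(Nat.cast_nonneg n : (0 : ℝ) ≤ n)]) (min_le_right _ _)⟩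
  have hgn_E : ∀ n (y : PhaseSpace N), |gn n y| ≤ E y := by
    intro n y
    refine le_trans ?_ (hgE y)
    rw [abs_le]
    constructor
    · refine le_max_of_le_right (le_min (neg_abs_le _) ?_)
      exact (Nat.cast_nonneg n).trans' (neg_nonpos.2 (abs_nonneg _)) |>.trans (le_refl _)
    · exact max_le ((neg_nonpos.2 (Nat.cast_nonneg n)).trans (abs_nonneg _))
        ((min_le_left _ _).trans (le_abs_self _))
  have hgn_lim : ∀ y : PhaseSpace N, Tendsto (fun n => gn n y) atTop (𝓝 (g y)) := by
    intro y
    refine tendsto_const_nhds.congr' ?_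
    filter_upwards [eventually_ge_atTop ⌈|g y|⌉₊] with n hn
    have hn' : |g y| ≤ n := (Nat.le_ceil _).trans (by exact_mod_cast hn)
    simp only [hgn]
    rw [min_eq_left ((le_abs_self _).trans hn'), max_eq_right ((neg_le_neg hn').trans (neg_abs_le _))]
  have hconv : ∀ (ν : Measure (PhaseSpace N)), ∫⁻ y, ENNReal.ofReal (E y) ∂ν ≠ ⊤ →
      Tendsto (fun n => ∫ y, gn n y ∂ν) atTop (𝓝 (∫ y, g y ∂ν)) := by
    intro ν hν
    refine tendsto_integral_of_dominated_convergence E (fun n => (hgn_cont n).aestronglyMeasurable)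
      (hEint ν hν) (fun n => Eventually.of_forall fun y => ?_) (Eventually.of_forall hgn_lim)
    rw [Real.norm_eq_abs]
    exact hgn_E n y
  have hlim := ((hconv μ hμV).sub (hconv μs hμsV)).abs
  exact le_of_tendsto' hlim fun n => hbdd (gn n) (hgn_cont n) ⟨n, hgn_bd n⟩ (hgn_E n)


/-- Registered helper sub-goal `helper_flipAsymmetryTransfer` of stmt-AtomisticToContinuum-11976
(= `exists_flipSteadyState_sub_le_of_flipAsymmetry`, fully quantified, notation-free one-line form). -/
theorem helper_flipAsymmetryTransfer : ∀ (ω₂ lam β γ : ℝ), 0 < ω₂ → 0 ≤ lam → 0 ≤ β → ∀ (N : ℕ), 0 < N → ∀ (T_L T_R ε : ℝ) (R : ProbabilityTheory.Kernel (Literature.MathematicalPhysics.KineticTheory.HeatConduction.PhaseSpace N) (Literature.MathematicalPhysics.KineticTheory.HeatConduction.PhaseSpace N)) [ProbabilityTheory.IsMarkovKernel R], (∀ f : Literature.MathematicalPhysics.KineticTheory.HeatConduction.PhaseSpace N → ℝ, ContDiff ℝ ((⊤ : ℕ∞) : WithTop ℕ∞) f → HasCompactSupport f → ∀ z : Literature.MathematicalPhysics.KineticTheory.HeatConduction.PhaseSpace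 N, MeasureTheory.integral (R z) (fun y => (Literature.MathematicalPhysics.KineticTheory.HeatConduction.pinnedChain ω₂ lam β γ).generator N T_L T_R f y) = ((N : ℝ) * ε) * (MeasureTheory.integral (R z) (fun y => f y) - f z)) → (∀ g : BoundedContinuousFunction (Literature.MathematicalPhysics.KineticTheory.HeatConduction.PhaseSpace N) ℝ, Continuous fun z => MeasureTheory.integral (R z) (fun y => g y)) → ∀ θ : ℝ, 0 < θ → ∀ a b : ENNReal, a < 1 → b ≠ (⊤ : ENNReal) → (∀ z : Literature.MathematicalPhysics.KineticTheory.HeatConduction.PhaseSpace N, MeasureTheory.lintegral (R z) (fun y => ENNReal.ofReal (Real.exp (θ * (Literature.MathematicalPhysics.KineticTheory.HeatConduction.pinnedChain ω₂ lam β γ).hamiltonian N y))) ≤ a * ENNReal.ofReal (Real.exp (θ * (Literature.MathematicalPhysics.KineticTheory.HeatConduction.pinnedChain ω₂ lam β γ).hamiltonian N z)) + b) → ∀ (μs : MeasureTheory.Measure (Literature.MathematicalPhysics.KineticTheory.HeatConduction.PhaseSpace N)) [MeasureTheory.IsProbabilityMeasure μs], MeasureTheory.lintegral μs (fun y => ENNReal.ofReal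 (Real.exp (θ * (Literature.MathematicalPhysics.KineticTheory.HeatConduction.pinnedChain ω₂ lam β γ).hamiltonian N y))) ≠ (⊤ : ENNReal) → μs.bind R = μs → ∀ κ : ℝ, 0 ≤ κ → κ < 1 → (∀ g : Literature.MathematicalPhysics.KineticTheory.HeatConduction.PhaseSpace N → ℝ, Continuous g → (∀ y, |g y| ≤ Real.exp (θ * (Literature.MathematicalPhysics.KineticTheory.HeatConduction.pinnedChain ω₂ lam β γ).hamiltonian N y)) → ∀ z : Literature.MathematicalPhysics.KineticTheory.HeatConduction.PhaseSpace N, |MeasureTheory.integral (R z) (fun y => g y) - MeasureTheory.integral μs (fun y => g y)| ≤ κ * Real.exp (θ * (Literature.MathematicalPhysics.KineticTheory.HeatConduction.pinnedChain ω₂ lam β γ).hamiltonian N z)) → ∀ A : ℝ, 0 ≤ A → (∀ (i : Fin N) (h : Literature.MathematicalPhysics.KineticTheory.HeatConduction.PhaseSpace N → ℝ), Continuous h → (∀ y, |h y| ≤ Real.exp (θ * (Literature.MathematicalPhysics.KineticTheory.HeatConduction.pinnedChain ω₂ lam β γ).hamiltonian N y)) → |MeasureTheory.integral μs (fun y =>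 h (Literature.MathematicalPhysics.KineticTheory.HeatConduction.momentumFlip i y)) - MeasureTheory.integral μs (fun y => h y)| ≤ A) → ∃ μ : MeasureTheory.Measure (Literature.MathematicalPhysics.KineticTheory.HeatConduction.PhaseSpace N), (Literature.MathematicalPhysics.KineticTheory.HeatConduction.pinnedChain ω₂ lam β γ).IsFlipSteadyState N T_L T_R ε μ ∧ ∀ g : Literature.MathematicalPhysics.KineticTheory.HeatConduction.PhaseSpace N → ℝ, Continuous g → (∀ y, |g y| ≤ Real.exp (θ * (Literature.MathematicalPhysics.KineticTheory.HeatConduction.pinnedChain ω₂ lam β γ).hamiltonian N y)) → |MeasureTheory.integral μ (fun y => g y) - MeasureTheory.integral μs (fun y => g y)| ≤ A * κ / (1 - κ) :=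
  fun _ _ _ _ hω hl hβ _ hN T_L T_R ε R _ hres hfeller _ hθ _ _ ha hb hlyap μs _ hμsV hinvR _ hκ0 hκ1
      hcontr _ hA hasym =>
    exists_flipSteadyState_sub_le_of_flipAsymmetry hω hl hβ hN T_L T_R ε R hres hfeller hθ ha hb hlyap μs
      hμsV hinvR hκ0 hκ1 hcontr hA hasym

end Abstract

end Summit.AtomisticToContinuum.FouriersLaw.Theorems.FixedLengthNoiseContinuity

end
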